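import Summits.Ventures.PercRepro.Night2FatZThreeB
import Summits.Ventures.PercRepro.Night2FatDegSingle

/-!
# night-2: the witnesses of the singly degenerate regime at small `N` — side points, free points, unloaded singletons — the case P₂ = {c, c'}, L₀ = {a}

**`exists_small_witnesses_deg`**: for every lossy basis pair of the singly degenerate regime there are sets `U` of side
points, `V` of free points and `E` of points on no non-class basis line (unloaded singletons) of `W ∖ {x}` in one of
four patterns: (α) the line of `M` is not a non-class basis line, `|U| = 2`, `|V| = 1`, `|E| ≥ 2`;
(β) `|U| = 1`, `|V| = 3`, `|E| ≥ 2`; (γ) `|U| = 2`, `|V| = 2`, `|E| ≥ 1`; (δ) `|U| = 1`, `|V| = 2`, `|E| ≥ 3`.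
Each pattern gives the fair share at `N = 6, 7, 8` (`Night2FatDegNumIccA/B`).  The case analysis follows
`exists_side_and_free_deg`: `|P₂| ∈ {0, 1, 2, 3}` basis points of `π₂` off the spine.
Paper `proofs/NIGHT-2-g35.md` §5.
-/

namespace PercRepro.Shadow

open PercRepro.ThmH PercRepro.PerFlat

variable {α : Type*} [DecidableEq α] {M : Matroid α} [M.Finite] {G : Finset α}

/-- The small witnesses when `P₂ = {c, c'}` and `L₀ = {a}` (`|P₃| = 1`): two side points. -/
theorem deg_wit_case_p2_two_l0_one {w₀ x : α} {R₁ : Finset α} {c₂ c₃ : α} {B : Finset α} {z : α}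
    (hd : (gr M \ G).card = 2) (hk : kColoops M G = 1) (hs : ∀ e ∈ gr M, ∀ f ∈ gr M, e ≠ f → rkN M {e, f} = 2)
    (hfat : (fatClosures M 5 G 2).card ≤ 1) (hR₁2 : rkN M R₁ = 2) (hR₁3 : 3 ≤ R₁.card)
    (hcop : rkN M (insert w₀ (insert x R₁)) ≤ 3)
    (hcover : ∀ e ∈ (G \ coloops M G) \ {w₀, x}, e ∈ clF M (insert c₂ R₁) ∨ e ∈ clF M (insert c₃ R₁))
    (hnd₂ : 3 ≤ rkN M (((G \ coloops M G) \ {w₀, x}).filter (fun e => e ∈ clF M (insert c₂ R₁) ∧ e ∉ clF M R₁)))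
    (hdeg₃ : rkN M (((G \ coloops M G) \ {w₀, x}).filter (fun e => e ∈ clF M (insert c₃ R₁) ∧ e ∉ clF M R₁)) ≤ 2)
    {V P W Mset P₃ M' L₀ P₂ Aset Lset : Finset α} (hV : V = (G \ coloops M G) \ {w₀, x})
    (hP : P = (insert z B \ coloops M G).erase w₀) (hW : W = (G \ insert z B).erase x)
    (hMset : Mset = V.filter (fun e => e ∈ clF M (insert c₃ R₁) ∧ e ∉ clF M R₁))
    (hP₃ : P₃ = P.filter (fun e => e ∈ Mset)) (hM' : M' = W.filter (fun e => e ∈ Mset))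
    (hL₀ : L₀ = P.filter (fun e => e ∈ clF M R₁))
    (hP₂ : P₂ = P.filter (fun e => e ∈ clF M (insert c₂ R₁) ∧ e ∉ clF M R₁))
    (hAset : Aset = V.filter (fun e => e ∈ clF M (insert c₂ R₁) ∧ e ∉ clF M R₁))
    (hLset : Lset = V.filter (fun e => e ∈ clF M R₁)) {y₃ c c' f : α} (hVg : V ⊆ gr M) (hPV : P ⊆ V)
    (hPW : ∀ e ∈ P, e ∉ W) (hP4 : P.card = 4) (hR₁g : R₁ ⊆ gr M) (hM3 : 3 ≤ Mset.card) (hM2 : 1 < Mset.card)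
    (hMne : Mset.Nonempty) (hP₃2 : P₃.card ≤ 2) (hMsplit : Mset.card = P₃.card + M'.card) (hM'1 : 1 ≤ M'.card)
    (hy₃ : y₃ ∈ W ∧ y₃ ∈ Mset) (hy₃side : y₃ ∈ clF M (insert c₃ R₁) ∧ y₃ ∉ clF M R₁) (hL₀2 : L₀.card ≤ 2)
    (hπ₂3 : (P.filter (fun e => e ∈ clF M (insert c₂ R₁))).card ≤ 3) (hL₀P₂ : L₀.card + P₂.card ≤ 3)
    (hsplit : L₀.card + P₂.card + P₃.card = 4) (hL3 : 3 ≤ Lset.card)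
    (hLM : ∀ s ∈ Lset, ∀ s' ∈ Lset, s ≠ s' → s ∈ clF M Mset → s' ∉ clF M Mset) (hAM : ∀ e ∈ Aset, e ∉ clF M Mset)
    (hpencil : ∀ c ∈ P₂, ∀ a ∈ P, ∀ b ∈ P, c ≠ a → c ≠ b → a ≠ b → rkN M (insert w₀ (insert x {c, a})) ≤ 3 → rkN M
      (insert w₀ (insert x {c, b})) ≤ 3 → False)
    (htwo : P₃.card ≤ 1 → ∃ y₃' ∈ W, y₃' ≠ y₃ ∧ (y₃' ∈ clF M (insert c₃ R₁) ∧ y₃' ∉ clF M R₁)) (hA3 : 3 ≤ Aset.card)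
    (hsingM : (¬ (4 ≤ rkN M (insert w₀ (insert x Mset)) ∧ ∃ a ∈ P, ∃ b ∈ P, a ≠ b ∧ a ∈ clF M Mset ∧ b ∈ clF M
      Mset)) → ∀ y ∈ W, (y ∈ clF M (insert c₃ R₁) ∧ y ∉ clF M R₁) → ∀ a ∈ P, ∀ b ∈ P, a ≠ b → y ∈ clF M {a, b} → rkN
      M (insert w₀ (insert x {a, b})) ≤ 3)
    (hnotcls : (4 ≤ rkN M (insert w₀ (insert x Mset))) → ∀ a ∈ L₀, a ∈ clF M Mset → ∀ c ∈ P₂, ¬ rkN M (insert w₀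
      (insert x {a, c})) ≤ 3)
    (hL₀1 : L₀.card ≤ 1) (hLWcard : Lset.card ≤ (Lset.filter (fun e => e ∈ W)).card + L₀.card)
    (hLline : ∀ c ∈ P₂, ∀ c' ∈ P, c ≠ c' → ∀ s ∈ Lset, ∀ s' ∈ Lset, s ≠ s' → s ∈ clF M {c, c'} → s' ∉ clF M {c, c'})
    (hcc' : c ≠ c') (hcmem : c ∈ P₂) (hc'mem : c' ∈ P₂) (hcP : c ∈ P) (hc'P : c' ∈ P)
    (hmem : ∀ e ∈ P₂, e = c ∨ e = c') (hX2 : rkN M ({c, c'} : Finset α) ≤ 2)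
    (hspinefree : ∀ s ∈ W, s ∈ clF M R₁ → s ∉ clF M Mset → (s ∈ clF M {c, c'} → rkN M (insert w₀ (insert x {c, c'}))
      ≤ 3 → 4 ≤ rkN M ({c, c'} ∪ Mset)) → s ∉ clF M Mset ∧ ∀ a ∈ P, ∀ b ∈ P, a ≠ b → s ∈ clF M {a, b} → rkN M
      (insert w₀ (insert x {a, b})) ≤ 3 → 4 ≤ rkN M ({a, b} ∪ Mset))
    (hspinesing : ∀ s ∈ W, s ∈ clF M R₁ → s ∉ clF M Mset → (s ∈ clF M {c, c'} → rkN M (insert w₀ (insert x {c, c'}))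
      ≤ 3) → ∀ a ∈ P, ∀ b ∈ P, a ≠ b → s ∈ clF M {a, b} → rkN M (insert w₀ (insert x {a, b})) ≤ 3)
    (hfW : f ∈ W) (hfL : f ∉ clF M R₁)
    (hffree_of : (∀ a ∈ L₀, ∀ d ∈ P₂, a ≠ d → f ∈ clF M {a, d} → rkN M (insert w₀ (insert x {a, d})) ≤ 3 → 4 ≤ rkN M
      ({a, d} ∪ Mset)) → f ∉ clF M Mset ∧ ∀ a ∈ P, ∀ b ∈ P, a ≠ b → f ∈ clF M {a, b} → rkN M (insert w₀ (insert x
      {a, b})) ≤ 3 → 4 ≤ rkN M ({a, b} ∪ Mset))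
    (hP₂2 : 2 ≤ P₂.card) (hP₂2' : P₂.card < 3) (hL₀1' : 1 ≤ L₀.card) :
    ∃ U V E : Finset α, U ⊆ (G \ insert z B).erase x ∧ (∀ y ∈ U, y ∈ clF M (insert c₃ R₁) ∧ y ∉ clF M R₁) ∧ V ⊆ (G
      \ insert z B).erase x ∧ (∀ f ∈ V, f ∉ clF M (((G \ coloops M G) \ {w₀, x}).filter (fun e => e ∈ clF M (insert
      c₃ R₁) ∧ e ∉ clF M R₁)) ∧ ∀ a ∈ (insert z B \ coloops M G).erase w₀, ∀ b ∈ (insert z B \ coloops M G).erase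
      w₀, a ≠ b → f ∈ clF M {a, b} → rkN M (insert w₀ (insert x {a, b})) ≤ 3 → 4 ≤ rkN M ({a, b} ∪ (((G \ coloops M
      G) \ {w₀, x}).filter (fun e => e ∈ clF M (insert c₃ R₁) ∧ e ∉ clF M R₁)))) ∧ E ⊆ (G \ insert z B).erase x ∧ (∀
      y ∈ E, ∀ a ∈ (insert z B \ coloops M G).erase w₀, ∀ b ∈ (insert z B \ coloops M G).erase w₀, a ≠ b → y ∈ clF M
      {a, b} → rkN M (insert w₀ (insert x {a, b})) ≤ 3) ∧ ((¬ (4 ≤ rkN M (insert w₀ (insert x (((G \ coloops M G) \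
      {w₀, x}).filter (fun e => e ∈ clF M (insert c₃ R₁) ∧ e ∉ clF M R₁)))) ∧ ∃ a ∈ (insert z B \ coloops M G).erase
      w₀, ∃ b ∈ (insert z B \ coloops M G).erase w₀, a ≠ b ∧ a ∈ clF M (((G \ coloops M G) \ {w₀, x}).filter (fun e
      => e ∈ clF M (insert c₃ R₁) ∧ e ∉ clF M R₁)) ∧ b ∈ clF M (((G \ coloops M G) \ {w₀, x}).filter (fun e => e ∈
      clF M (insert c₃ R₁) ∧ e ∉ clF M R₁))) ∧ U.card = 2 ∧ V.card = 1 ∧ 2 ≤ E.card) ∨ (U.card = 1 ∧ V.card = 3 ∧ 2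
      ≤ E.card) ∨ (U.card = 2 ∧ V.card = 2 ∧ 1 ≤ E.card) ∨ (U.card = 1 ∧ V.card = 2 ∧ 3 ≤ E.card)) := by
  subst hV hP hW hMset hP₃ hM' hL₀ hP₂ hAset hLset
  set V := (G \ coloops M G) \ {w₀, x} with hV
  set P := (insert z B \ coloops M G).erase w₀ with hP
  set W := (G \ insert z B).erase x with hW
  set Mset := V.filter (fun e => e ∈ clF M (insert c₃ R₁) ∧ e ∉ clF M R₁) with hMset
  set P₃ := P.filter (fun e => e ∈ Mset) with hP₃
  set M' := W.filter (fun e => e ∈ Mset) with hM'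
  set L₀ := P.filter (fun e => e ∈ clF M R₁) with hL₀
  set P₂ := P.filter (fun e => e ∈ clF M (insert c₂ R₁) ∧ e ∉ clF M R₁) with hP₂
  set Aset := V.filter (fun e => e ∈ clF M (insert c₂ R₁) ∧ e ∉ clF M R₁) with hAset
  set Lset := V.filter (fun e => e ∈ clF M R₁) with hLset
  have _u := hd
  have _u := hk
  have _u := hfat
  have _u := hR₁2
  have _u := hR₁3
  have _u := hcop
  have _u := hnd₂
  have _u := hdeg₃
  have _u := hP4
  have _u := hM3
  have _u := hM2
  have _u := hP₃2
  have _u := hMsplit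
  have _u := hM'1
  have _u := hL₀2
  have _u := hπ₂3
  have _u := hL₀P₂
  have _u := hsplit
  have _u := hL3
  have _u := hA3
  have _u := hL₀1
  have _u := hLWcard
  have _u := hX2
  have _u := hP₂2
  have _u := hP₂2'
  have _u := hL₀1'
  obtain ⟨y₃', hy₃'W, hyy, hy₃'side⟩ := htwo (by omega)
  have hUc : ({y₃, y₃'} : Finset α).card = 2 := Finset.card_pair (Ne.symm hyy)
  have hUW : ({y₃, y₃'} : Finset α) ⊆ W :=
    Finset.insert_subset hy₃.1 (Finset.singleton_subset_iff.2 hy₃'W)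
  have hUside : ∀ y ∈ ({y₃, y₃'} : Finset α), y ∈ clF M (insert c₃ R₁) ∧ y ∉ clF M R₁ := by
    intro y hy
    rw [Finset.mem_insert, Finset.mem_singleton] at hy
    rcases hy with rfl | rfl
    · exact hy₃side
    · exact hy₃'side
  obtain ⟨a, haL₀⟩ := Finset.card_eq_one.1 (by omega : L₀.card = 1)
  have hamem : a ∈ L₀ := by rw [haL₀]; exact Finset.mem_singleton_self a
  have haonly : ∀ e ∈ L₀, e = a := fun e he => by rw [haL₀, Finset.mem_singleton] at he; exact he
  have haP : a ∈ P := (Finset.mem_filter.1 hamem).1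
  have haL : a ∈ clF M R₁ := (Finset.mem_filter.1 hamem).2
  -- the spine points of `W` (at least two)
  have hLW2 : 1 < (Lset.filter (fun e => e ∈ W)).card := by omega
  by_cases hNCL : ¬ (4 ≤ rkN M (insert w₀ (insert x Mset)) ∧
      ∃ a ∈ P, ∃ b ∈ P, a ≠ b ∧ a ∈ clF M Mset ∧ b ∈ clF M Mset)
  · -- pattern (α): a free point; `E = U`
    have hEsing : ∀ y ∈ ({y₃, y₃'} : Finset α), ∀ a' ∈ P, ∀ b ∈ P, a' ≠ b → y ∈ clF M {a', b} →
        rkN M (insert w₀ (insert x {a', b})) ≤ 3 := fun y hy => hsingM hNCL y (hUW hy) (hUside y hy)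
    by_cases hccls : rkN M (insert w₀ (insert x {c, c'})) ≤ 3
    · -- `{c, c'}` a class line: the lines `{a, c}`, `{a, c'}` are not class lines; `f` is free
      have hffree := hffree_of (by
        intro a' ha' d hd _ hfad hcls
        have ha'a : a' = a := haonly a' ha'
        subst ha'a
        exfalso
        rcases hmem d hd with rfl | rfl
        · rw [Finset.pair_comm] at hcls
          exact hpencil d hcmem a' haP c' hc'P (fun h => (Finset.mem_filter.1 hcmem).2.2 (h ▸ haL)) hcc'
            (fun h => (Finset.mem_filter.1 hc'mem).2.2 (h ▸ haL)) hcls hccls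
        · rw [Finset.pair_comm] at hcls hccls
          exact hpencil d hc'mem a' haP c hcP (fun h => (Finset.mem_filter.1 hc'mem).2.2 (h ▸ haL))
            (Ne.symm hcc') (fun h => (Finset.mem_filter.1 hcmem).2.2 (h ▸ haL)) hcls hccls)
      refine ⟨{y₃, y₃'}, {f}, {y₃, y₃'}, hUW, hUside, Finset.singleton_subset_iff.2 hfW, ?_, hUW, hEsing,
        Or.inl ⟨hNCL, hUc, Finset.card_singleton _, by rw [hUc]⟩⟩
      intro g hg
      rw [Finset.mem_singleton] at hg
      subst hg
      exact hffree
    · -- `{c, c'}` not a class line: a spine point of `W` off `clF M` is free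
      obtain ⟨s, hsm, s', hs'm, hss'⟩ := Finset.one_lt_card.1 hLW2
      rw [Finset.mem_filter] at hsm hs'm
      obtain ⟨t, htm, htM⟩ : ∃ t, (t ∈ Lset ∧ t ∈ W) ∧ t ∉ clF M Mset := by
        by_cases hsM : s ∈ clF M Mset
        · exact ⟨s', hs'm, hLM s hsm.1 s' hs'm.1 hss' hsM⟩
        · exact ⟨s, hsm, hsM⟩
      have htfree := hspinefree t htm.2 (Finset.mem_filter.1 htm.1).2 htM (fun _ h => absurd h hccls)
      refine ⟨{y₃, y₃'}, {t}, {y₃, y₃'}, hUW, hUside, Finset.singleton_subset_iff.2 htm.2, ?_, hUW, hEsing,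
        Or.inl ⟨hNCL, hUc, Finset.card_singleton _, by rw [hUc]⟩⟩
      intro g hg
      rw [Finset.mem_singleton] at hg
      subst hg
      exact htfree
  · -- pattern (γ): the line of `M` is a non-class basis line through the spine basis point `a ∈ clF M`;
    -- `{a, c}`, `{a, c'}` are not class lines; `f` and a spine point off `clF {c, c'}` are free
    push Not at hNCL
    obtain ⟨hM4, a₀, ha₀P, b₀, hb₀P, hab₀, ha₀M, hb₀M⟩ := hNCL
    -- the spine point `a` is in `clF M` (one of `a₀, b₀` is a spine point of `clF M`, which is `a`)
    have hside : ∀ t ∈ P, t ∈ clF M Mset → t ∉ Mset → t ∈ clF M R₁ := by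
      intro t ht htM htS
      rcases spine_or_plane_or_side hcover (hPV ht) with h | ⟨h2, hL⟩ | h
      · exact h
      · exact absurd htM (hAM t (Finset.mem_filter.2 ⟨hPV ht, h2, hL⟩))
      · exact absurd (Finset.mem_filter.2 ⟨hPV ht, h⟩) htS
    have haM : a ∈ clF M Mset := by
      by_cases ha₀S : a₀ ∈ Mset
      · by_cases hb₀S : b₀ ∈ Mset
        · exfalso
          have : ({a₀, b₀} : Finset α) ⊆ P₃ := by
            intro t ht
            rw [Finset.mem_insert, Finset.mem_singleton] at ht
            rcases ht with rfl | rfl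
            · exact Finset.mem_filter.2 ⟨ha₀P, ha₀S⟩
            · exact Finset.mem_filter.2 ⟨hb₀P, hb₀S⟩
          have := Finset.card_le_card this
          rw [Finset.card_pair hab₀] at this
          omega
        · have hb₀L := hside b₀ hb₀P hb₀M hb₀S
          have : b₀ = a := haonly b₀ (Finset.mem_filter.2 ⟨hb₀P, hb₀L⟩)
          subst this
          exact hb₀M
      · have ha₀L := hside a₀ ha₀P ha₀M ha₀S
        have : a₀ = a := haonly a₀ (Finset.mem_filter.2 ⟨ha₀P, ha₀L⟩)
        subst this
        exact ha₀M
    have hnoac : ∀ a' ∈ L₀, ∀ d ∈ P₂, a' ≠ d → f ∈ clF M {a', d} →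
        rkN M (insert w₀ (insert x {a', d})) ≤ 3 → 4 ≤ rkN M ({a', d} ∪ Mset) := by
      intro a' ha' d hd _ _ hcls
      have ha'a : a' = a := haonly a' ha'
      subst ha'a
      exact absurd hcls (hnotcls hM4 a' hamem haM d hd)
    have hffree := hffree_of hnoac
    -- spine points of `W` are all off `clF M` (the spine point of `clF M` is `a ∉ W`)
    have hLoff : ∀ s ∈ Lset, s ∈ W → s ∉ clF M Mset := by
      intro s hs' hsW hsM
      have : a = s := eq_of_mem_spine_of_mem_clF_side hs hVg hR₁g hR₁2 hdeg₃ hMne (hVg (hPV haP))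
        (hVg (Finset.mem_filter.1 hs').1) haL (Finset.mem_filter.1 hs').2 haM hsM
      subst this
      exact hPW a haP hsW
    obtain ⟨s, hsm, s', hs'm, hss'⟩ := Finset.one_lt_card.1 hLW2
    rw [Finset.mem_filter] at hsm hs'm
    -- a spine point of `W` off `clF {c, c'}`
    obtain ⟨t, htm, htX⟩ : ∃ t, (t ∈ Lset ∧ t ∈ W) ∧ t ∉ clF M {c, c'} := by
      by_cases hsX : s ∈ clF M {c, c'}
      · exact ⟨s', hs'm, hLline c hcmem c' hc'P hcc' s hsm.1 s' hs'm.1 hss' hsX⟩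
      · exact ⟨s, hsm, hsX⟩
    have htM : t ∉ clF M Mset := hLoff t htm.1 htm.2
    have htL : t ∈ clF M R₁ := (Finset.mem_filter.1 htm.1).2
    have htfree := hspinefree t htm.2 htL htM (fun h => absurd h htX)
    have htsing := hspinesing t htm.2 htL htM (fun h => absurd h htX)
    have hft : f ≠ t := by
      rintro rfl
      exact hfL htL
    refine ⟨{y₃, y₃'}, {f, t}, {t}, hUW, hUside, ?_, ?_, Finset.singleton_subset_iff.2 htm.2, ?_,
      Or.inr (Or.inr (Or.inl ⟨hUc, Finset.card_pair hft, by rw [Finset.card_singleton]⟩))⟩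
    · intro g hg
      rw [Finset.mem_insert, Finset.mem_singleton] at hg
      rcases hg with rfl | rfl
      · exact hfW
      · exact htm.2
    · intro g hg
      rw [Finset.mem_insert, Finset.mem_singleton] at hg
      rcases hg with rfl | rfl
      · exact hffree
      · exact htfree
    · intro y hy
      rw [Finset.mem_singleton] at hy
      subst hy
      exact htsing

end PercRepro.Shadow
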